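import Summits.CriticalPhenomena.PercolationContinuityZ3.Theses.PercPortalLadder
import Summits.CriticalPhenomena.PercolationContinuityZ3.Theorems.PercNearOneGluingNoHeavyLowerTailCSHTheoremOne
import Literature.Probability.Percolation.CoveringMonotonicity
import Literature.Probability.Percolation.ConnectivityProofs
import HarnessLib

/-!
# `PercPortalLadder.FreeRung` (stmt-CriticalPhenomena-6261) — SETTLED after continuity

Item `stmt-CriticalPhenomena-6261` of route `CriticalPhenomena/PercPortalLadder` (support): the free rung: an INFINITE portal set `P ⊆ {x₀ = 0}` with `S(P)`.

With `θ(p_c(ℤ³)) = 0` (p205010), `θ` of every edge-deleted subgraph of `ℤ³` vanishes at `p_c` at every vertex: deleting edges can only lower `θ` (Lyons–Peres Thm 6.47 covering inequality `LyonsPeres647.theta_le_of_surjOn_neighborSet` with the identity map) and `θ_{ℤ³}(v, p_c) = θ_{ℤ³}(0, p_c) = 0`.  Witness `P = {x₀ = 0}` (the whole plane, infinite along `ℤe₁`).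

builds on p205010 (kernel theorem, internal audit signed; external expert review pending) — USED (`CSH.percolationContinuityZ3_holds`).  RSW3 lane, lead gen 28 (prover-prim-rsw3-lead-g28-0):
'after continuity — the ledger harvest'.
References: G. Kozma, N. Nitzan (2024), Thm. 6 / Conj. 3 [KozmaNitzan2024]; G. Grimmett, *Percolation* (1999), §8 [GrimmettPercolation1999].
-/

noncomputable section

namespace Summit.CriticalPhenomena.PercolationContinuityZ3.Theorems

namespace PercPortalLadderFreeRung

open MeasureTheory Literature.Probability.Percolation Literature.Probability.LatticeModels

/-- **`PercPortalLadder.FreeRung` (stmt-CriticalPhenomena-6261), settled.**  witness `P = {x₀ = 0}`; `θ_{ℤ³∖W_P}(v,p_c) ≤ θ_{ℤ³}(0,p_c) = 0`.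
[cite: KozmaNitzan2024, Thm. 6 with Conj. 3 (p. 15)] -/
theorem freeRung_proof : Summit.CriticalPhenomena.PercolationContinuityZ3.Theses.PercPortalLadder.FreeRung := by
  unfold Summit.CriticalPhenomena.PercolationContinuityZ3.Theses.PercPortalLadder.FreeRung
  refine ⟨{x : Site 3 | x 0 = 0}, subset_rfl, ?_, fun v => ?_⟩
  · refine Set.infinite_of_injective_forall_mem (f := fun n : ℤ => (Pi.single 1 n : Site 3)) ?_ ?_
    · intro a b h
      have := congrArg (fun x : Site 3 => x 1) h
      simpa using this
    · intro n
      simp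
  have h0 : theta (zdGraph 3) (0 : Site 3) (criticalProbI 3) = 0 := CSH.percolationContinuityZ3_holds
  have key : ∀ E : Set (Sym2 (Site 3)),
      theta ((zdGraph 3).deleteEdges E) v (criticalProbI 3) ≤ theta (zdGraph 3) v (criticalProbI 3) := fun E => by
    refine LyonsPeres647.theta_le_of_surjOn_neighborSet (zdGraph 3) _ id (fun x => ?_) v (criticalProbI 3)
    intro y hy
    refine ⟨y, ?_, rfl⟩
    rw [SimpleGraph.mem_neighborSet, SimpleGraph.deleteEdges_adj] at hy
    rw [SimpleGraph.mem_neighborSet]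
    exact hy.1
  rw [theta_zdGraph_eq_theta_zero, h0] at key
  exact le_antisymm (key _) (by unfold theta; exact measureReal_nonneg)

end PercPortalLadderFreeRung

end Summit.CriticalPhenomena.PercolationContinuityZ3.Theorems

end
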